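import Mathlib
import HarnessLib
import Literature.Computability.AlgebraicComplexity.ArithCircuit
import Literature.Computability.AlgebraicComplexity.SupportSymmetrisation
import Summits.ValiantsHypothesis.ValiantsHypothesis.Theorems.MonotoneRestorationMonotoneRestorationQPRowScanGates
import Summits.ValiantsHypothesis.ValiantsHypothesis.Theorems.MonotoneRestorationMonotoneRestorationQPRowScanRowParts

/-!
# ValiantsHypothesis / MonotoneRestoration — `MonotoneRestorationQP`, line `Sketch`, stub D3

Support file for crux item `stmt-ValiantsHypothesis-15886`
(`Summit.ValiantsHypothesis.ValiantsHypothesis.Theses.MonotoneRestoration.MonotoneRestorationQP`),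
line `Sketch`, stub `stub_rowScan_rowBlocks` — Theorem δ ("commuting row scans restore with
polynomial symmetric size"), the ROW BLOCKS of the scan program.

A row scan has transfer matrices `A_i = (H a b (p_1(r_i), …, p_D(r_i)))_{a,b}`, where
`p_d(r_i) = Σ_j x_{ij}^d` are the power sums of row `i` of the `n × n` variable matrix and the
`H a b ∈ ℂ[z_0, …, z_{D-1}]` are sparse templates (`≤ T` monomials, degree `≤ Eh`). This file
builds, as ONE supported straight-line program in the input format of
`SupportSymm.exists_symmetric_circuit_of_supports` (non-nullary gates of fan-in
`≤ n + w + D + T + Eh + 1`, well formed, supports of size `≤ 2`, hereditary supports of product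
gates, every gate value invariant under the diagonal renamings fixing its support pointwise),
for every row `i`: the power sums `p_{d+1}(r_i)` (`rowScanBlocks_powerSums`: powers `x_{ij}^{d+1}`
at support `{i, j}`, full row sums at support `{i}`), the entries of `A_i`
(`rowScanBlocks_aeval`, support `{i}`) and the matrix powers `A_i^{k+1}`, `k < n`
(`rowScanBlocks_matPow`, support `{i}`), together with an index map locating the entries of
`A_i^{k+1}`; at most `(n + w + D + T + Eh + 2)^8` gates. The invariant is carried abstractly
through the blocks (`…QPRowScanRowParts.lean`) and instantiated here with the extension lemmas
`rowScanGates_step` / `rowScanGates_step_hered` (`…QPRowScanGates.lean`).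

## References

* P. Bürgisser, *Completeness and Reduction in Algebraic Complexity Theory*, Springer 2000,
  Def. 2.1 (straight-line programs).
* A. Dawar, G. Wilsenach, *Symmetric Arithmetic Circuits*, Theory of Computing 21 (2025), §3.
-/

-- `Summit.ValiantsHypothesis.ValiantsHypothesis.…` is the tree's mandated single-conjunct layout
-- (Sub = Summit), so the duplicated namespace component is intended.
set_option linter.dupNamespace false

open Literature.Computability.AlgebraicComplexity MvPolynomial

namespace Summit.ValiantsHypothesis.ValiantsHypothesis.Theorems

/-! ### One row -/

section Row

variable {F : Type*} [CommSemiring F] {n : ℕ} (A : ℕ)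
  (Inv : List (ArithCircuit.Gate F (Fin n × Fin n)) → (ℕ → Finset (Fin n)) → Prop)
  (hcore : ∀ (L : List (ArithCircuit.Gate F (Fin n × Fin n))) (K : ℕ → Finset (Fin n))
    (g : ArithCircuit.Gate F (Fin n × Fin n)) (S : Finset (Fin n)), Inv L K → g.args ≠ [] →
    g.fanIn ≤ A → (∀ u ∈ g.args, u.RefsBelow L.length) → S.card ≤ 2 →
    (∀ us, g = .prod us → ∀ u ∈ us, SupportSymm.osupp K u ⊆ S) →
    (∀ σ : Equiv.Perm (Fin n), (∀ x ∈ S, σ x = x) →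
      rename (fun pq : Fin n × Fin n => (σ pq.1, σ pq.2)) (g.eval (ArithCircuit.gateValues L)) =
        g.eval (ArithCircuit.gateValues L)) →
    Inv (L ++ [g]) (Function.update K L.length S))
  (hhered : ∀ (L : List (ArithCircuit.Gate F (Fin n × Fin n))) (K : ℕ → Finset (Fin n))
    (g : ArithCircuit.Gate F (Fin n × Fin n)) (S : Finset (Fin n)), Inv L K → g.args ≠ [] →
    g.fanIn ≤ A → (∀ u ∈ g.args, u.RefsBelow L.length) → S.card ≤ 2 →
    (∀ u ∈ g.args, SupportSymm.osupp K u ⊆ S) → Inv (L ++ [g]) (Function.update K L.length S))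

include hcore hhered in
/-- **The block of row `i`.** From `(L, K)` satisfying `Inv`, at most
`D (n + 1) + w² (T + 1) + n w² (w + 1)` more gates locate every entry of every power
`A_i^{k+1}`, `k < n`, of the transfer matrix `A_i = (H a b (p_1(r_i), …, p_D(r_i)))_{a,b}` at
support `{i}`: power sums (`rowScanBlocks_powerSums`), entries (`rowScanBlocks_aeval` for each
`(a, b)`), powers (`rowScanBlocks_matPow`). [folklore] -/
theorem rowScanRowBlocks_row {w D T Eh : ℕ} (hAn : n + 1 ≤ A) (hAD : D ≤ A) (hAT : T + 1 ≤ A)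
    (hAE : Eh + 1 ≤ A) (hAw : w + 1 ≤ A) (hA2 : 2 ≤ A) (H : Fin w → Fin w → MvPolynomial (Fin D) F)
    (hT : ∀ a b, (H a b).support.card ≤ T) (hE : ∀ a b, (H a b).totalDegree ≤ Eh) (i : Fin n)
    (L : List (ArithCircuit.Gate F (Fin n × Fin n))) (K : ℕ → Finset (Fin n)) (hInv : Inv L K) :
    ∃ (L' : List (ArithCircuit.Gate F (Fin n × Fin n))) (K' : ℕ → Finset (Fin n)), L <+: L' ∧
      (∀ t < L.length, K' t = K t) ∧
      L'.length ≤ L.length + (D * (n + 1) + w * w * (T + 1) + n * (w * w * (w + 1))) ∧ Inv L' K' ∧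
      ∀ y : Fin n × Fin w × Fin w, ∃ t < L'.length, K' t = {i} ∧
        (ArithCircuit.gateValues L').getD t 0 =
          ((Matrix.of fun a' b' : Fin w => aeval
            (fun d : Fin D => ∑ j : Fin n,
              (X (i, j) : MvPolynomial (Fin n × Fin n) F) ^ ((d : ℕ) + 1))
            (H a' b')) ^ ((y.1 : ℕ) + 1)) y.2.1 y.2.2 := by
  have hSi : ({i} : Finset (Fin n)).card ≤ 2 := (Finset.card_singleton i).trans_le one_le_two
  -- the power sums `p_{d+1}(r_i)`
  obtain ⟨L₁, K₁, hpre₁, hagr₁, hlen₁, hInv₁, hps⟩ :=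
    rowScanBlocks_powerSums A Inv hcore hhered D hAn hAD i L K hInv
  choose ps hps using hps
  -- the entries of `A_i`
  obtain ⟨L₂, K₂, hpre₂, hagr₂, hlen₂, hInv₂, hent⟩ := rowScanGates_iter (ι := Fin w × Fin w)
    (β := Unit) Inv (fun _ _ => ({i} : Finset (Fin n)))
    (fun ab _ => aeval (fun d : Fin D => ∑ j : Fin n,
      (X (i, j) : MvPolynomial (Fin n × Fin n) F) ^ ((d : ℕ) + 1)) (H ab.1 ab.2)) (T + 1) L₁ K₁
    (fun ab L' K' hpre' hagr' hInv' => rowScanBlocks_aeval A Inv hhered hAT hAE {i} hSi _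
      (H ab.1 ab.2) (hT _ _) (hE _ _) L₁ K₁ ps hps L' K' hpre' hagr' hInv') hInv₁
  choose ent hent using fun ab => hent ab ()
  -- the powers `A_i^{k+1}`, `k ≤ n - 1`
  obtain ⟨L₃, K₃, hpre₃, hagr₃, hlen₃, hInv₃, hpow⟩ := rowScanBlocks_matPow A Inv hhered hAw hA2 {i}
    hSi (Matrix.of fun a' b' : Fin w => aeval (fun d : Fin D => ∑ j : Fin n,
      (X (i, j) : MvPolynomial (Fin n × Fin n) F) ^ ((d : ℕ) + 1)) (H a' b'))
    L₂ K₂ (fun a b => ent (a, b)) (fun a b => hent (a, b)) hInv₂ (n - 1)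
  refine ⟨L₃, K₃, hpre₁.trans (hpre₂.trans hpre₃), fun t ht => ?_, ?_, hInv₃, fun y => ?_⟩
  · rw [hagr₃ t (lt_of_lt_of_le ht (hpre₁.trans hpre₂).length_le),
      hagr₂ t (lt_of_lt_of_le ht hpre₁.length_le), hagr₁ t ht]
  · have h : (n - 1) * (w * w * (w + 1)) ≤ n * (w * w * (w + 1)) :=
      Nat.mul_le_mul_right _ (Nat.sub_le n 1)
    simp only [Fintype.card_prod, Fintype.card_fin] at hlen₂
    omega
  · exact hpow y.1 (by have := y.1.2; omega) y.2.1 y.2.2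

end Row

/-! ### The gate count -/

/-- The gate count of the row blocks: `n (D (n + 1) + w² (T + 1) + n w² (w + 1)) ≤ N^8`,
`N = n + w + D + T + Eh + 2`. [folklore] -/
theorem rowScanRowBlocks_count_le (n w D T Eh : ℕ) :
    n * (D * (n + 1) + w * w * (T + 1) + n * (w * w * (w + 1))) ≤ (n + w + D + T + Eh + 2) ^ 8 := by
  have hn : n ≤ n + w + D + T + Eh + 2 := by omega
  have hn1 : n + 1 ≤ n + w + D + T + Eh + 2 := by omega
  have hD : D ≤ n + w + D + T + Eh + 2 := by omega
  have hw : w ≤ n + w + D + T + Eh + 2 := by omega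
  have hw1 : w + 1 ≤ n + w + D + T + Eh + 2 := by omega
  have hT1 : T + 1 ≤ n + w + D + T + Eh + 2 := by omega
  have h2 : 2 ≤ n + w + D + T + Eh + 2 := by omega
  generalize n + w + D + T + Eh + 2 = N at hn hn1 hD hw hw1 hT1 h2
  have e1 : n * (D * (n + 1)) ≤ N ^ 5 := by
    calc n * (D * (n + 1)) ≤ N * (N * N) := Nat.mul_le_mul hn (Nat.mul_le_mul hD hn1)
      _ = N ^ 3 := by ring
      _ ≤ N ^ 5 := Nat.pow_le_pow_right (by omega) (by omega)
  have e2 : n * (w * w * (T + 1)) ≤ N ^ 5 := by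
    calc n * (w * w * (T + 1)) ≤ N * (N * N * N) :=
          Nat.mul_le_mul hn (Nat.mul_le_mul (Nat.mul_le_mul hw hw) hT1)
      _ = N ^ 4 := by ring
      _ ≤ N ^ 5 := Nat.pow_le_pow_right (by omega) (by omega)
  have e3 : n * (n * (w * w * (w + 1))) ≤ N ^ 5 := by
    calc n * (n * (w * w * (w + 1))) ≤ N * (N * (N * N * N)) :=
          Nat.mul_le_mul hn (Nat.mul_le_mul hn (Nat.mul_le_mul (Nat.mul_le_mul hw hw) hw1))
      _ = N ^ 5 := by ring
  have h8 : 3 * N ^ 5 ≤ N ^ 8 := by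
    calc 3 * N ^ 5 ≤ N ^ 3 * N ^ 5 :=
          Nat.mul_le_mul_right _ (le_trans (by norm_num) (Nat.pow_le_pow_left h2 3))
      _ = N ^ 8 := by ring
  rw [Nat.mul_add, Nat.mul_add]
  omega

/-! ### The stub -/

/-- **D3 — the ROW BLOCKS of the scan program.** A well-formed gate list over `ℂ` with a support
annotation of width `≤ 2` (powers `x_ij^d` at support `{i,j}`, power sums, template entries and
the matrix powers `A_i^{k}`, `1 ≤ k ≤ n`, at support `{i}`), non-nullary gates of bounded fan-in,
hereditary product supports, every gate value invariant under the diagonal renamings fixing its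
support pointwise, and an index map locating the entries of `A_i^{k+1}`. [folklore] -/
theorem stub_rowScan_rowBlocks (n w D T Eh : ℕ) (H : Fin w → Fin w → MvPolynomial (Fin D) ℂ)
    (hT : ∀ a b, (H a b).support.card ≤ T) (hE : ∀ a b, (H a b).totalDegree ≤ Eh) :
    ∃ (L : List (ArithCircuit.Gate ℂ (Fin n × Fin n))) (K : ℕ → Finset (Fin n))
      (idx : Fin n → Fin n → Fin w → Fin w → ℕ),
      (∀ g ∈ L, g.args ≠ []) ∧
      (∀ g ∈ L, g.fanIn ≤ n + w + D + T + Eh + 1) ∧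
      (∀ (i : ℕ) (g : ArithCircuit.Gate ℂ (Fin n × Fin n)), L[i]? = some g →
        ∀ u ∈ g.args, u.RefsBelow i) ∧
      (∀ i, (K i).card ≤ 2) ∧
      (∀ (i : ℕ) (us : List (ArithCircuit.Operand ℂ (Fin n × Fin n))),
        L[i]? = some (.prod us) → ∀ u ∈ us, SupportSymm.osupp K u ⊆ K i) ∧
      (∀ (i : ℕ) (σ : Equiv.Perm (Fin n)), i < L.length → (∀ x ∈ K i, σ x = x) →
        MvPolynomial.rename (fun pq : Fin n × Fin n => (σ pq.1, σ pq.2))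
          ((ArithCircuit.gateValues L).getD i 0) = (ArithCircuit.gateValues L).getD i 0) ∧
      (∀ (i k : Fin n) (a b : Fin w), idx i k a b < L.length ∧ K (idx i k a b) = {i} ∧
        (ArithCircuit.gateValues L).getD (idx i k a b) 0 =
          ((Matrix.of fun a' b' : Fin w => MvPolynomial.aeval
              (fun d : Fin D => ∑ j : Fin n, (MvPolynomial.X (i, j) : MvPolynomial (Fin n × Fin n) ℂ)
                ^ ((d : ℕ) + 1)) (H a' b')) ^ ((k : ℕ) + 1)) a b) ∧
      L.length ≤ (n + w + D + T + Eh + 2) ^ 8 := by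
  -- all rows, starting from the empty program; the invariant = the six structural properties
  obtain ⟨L, K, -, -, hlen, ⟨h1, h2, h3, h4, h5, h6⟩, hfacts⟩ := rowScanGates_iter (ι := Fin n)
    (β := Fin n × Fin w × Fin w)
    (fun (L : List (ArithCircuit.Gate ℂ (Fin n × Fin n))) (K : ℕ → Finset (Fin n)) =>
      (∀ g ∈ L, g.args ≠ []) ∧ (∀ g ∈ L, g.fanIn ≤ n + w + D + T + Eh + 1) ∧
      (∀ (i : ℕ) (g : ArithCircuit.Gate ℂ (Fin n × Fin n)), L[i]? = some g →
        ∀ u ∈ g.args, u.RefsBelow i) ∧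
      (∀ i, (K i).card ≤ 2) ∧
      (∀ (i : ℕ) (us : List (ArithCircuit.Operand ℂ (Fin n × Fin n))),
        L[i]? = some (.prod us) → ∀ u ∈ us, SupportSymm.osupp K u ⊆ K i) ∧
      (∀ (i : ℕ) (σ : Equiv.Perm (Fin n)), i < L.length → (∀ x ∈ K i, σ x = x) →
        rename (fun pq : Fin n × Fin n => (σ pq.1, σ pq.2))
          ((ArithCircuit.gateValues L).getD i 0) = (ArithCircuit.gateValues L).getD i 0))
    (fun i _ => ({i} : Finset (Fin n)))
    (fun i y => ((Matrix.of fun a' b' : Fin w => aeval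
      (fun d : Fin D => ∑ j : Fin n, (X (i, j) : MvPolynomial (Fin n × Fin n) ℂ) ^ ((d : ℕ) + 1))
      (H a' b')) ^ ((y.1 : ℕ) + 1)) y.2.1 y.2.2)
    (D * (n + 1) + w * w * (T + 1) + n * (w * w * (w + 1))) [] (fun _ => ∅)
    (fun i L' K' _ _ hInv' => rowScanRowBlocks_row (n + w + D + T + Eh + 1) _
      (fun L K g S hI hg1 hg2 hg3 hS hg5 hg6 => rowScanGates_step _ L K g S hI.1 hI.2.1 hI.2.2.1
        hI.2.2.2.1 hI.2.2.2.2.1 hI.2.2.2.2.2 hg1 hg2 hg3 hS hg5 hg6)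
      (fun L K g S hI hg1 hg2 hg3 hS hg4 => rowScanGates_step_hered _ L K g S hI.1 hI.2.1
        hI.2.2.1 hI.2.2.2.1 hI.2.2.2.2.1 hI.2.2.2.2.2 hg1 hg2 hg3 hS hg4)
      (by omega) (by omega) (by omega) (by omega) (by omega) (by have := i.pos; omega)
      H hT hE i L' K' hInv')
    ⟨by simp, by simp, by simp, by simp, by simp, by simp⟩
  choose idx hidx using hfacts
  refine ⟨L, K, fun i k a b => idx i (k, a, b), h1, h2, h3, h4, h5, h6,
    fun i k a b => hidx i (k, a, b), ?_⟩
  rw [List.length_nil, Nat.zero_add, Fintype.card_fin] at hlen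
  exact hlen.trans (rowScanRowBlocks_count_le n w D T Eh)

end Summit.ValiantsHypothesis.ValiantsHypothesis.Theorems
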